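import Mathlib
import Summits.Ventures.HodgeRepro2.T5ContinuousCharacterExtension
import Summits.Ventures.HodgeRepro2.T5RamifiedUnitFiltration

/-!
# Inflating a character of the unit group to the multiplicative group, trivial on the base
  (the ramified case of the (A10)-type inflation)

`T5ConductorExistenceInflated.exists_extension_trivial_on` (the INERT inflation) extends a
character of `Sˣ` trivial on `Sˣ ∩ F` to a character of `Lˣ` trivial on `F`, using that `F`
contains the uniformiser `ϖ` (true at an inert place: `π_F = ϖ_E`). At a RAMIFIED place
`F_v^×` does not contain a uniformiser of `E_v` (`π_F = u ϖ_E²`), so the inert device fails. This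
file proves the extension in general: for subgroups `U`, `F` of an abelian group `G` and a
character `χ` of `U` trivial on `U ⊓ F` there is a character of `G` extending `χ` and trivial on
`F` — the SECOND ISOMORPHISM THEOREM `(U ⊔ F)/F ≅ U/(U ⊓ F)` (Mathlib's
`QuotientGroup.quotientInfEquivProdNormalQuotient`) followed by Baer's extension from `U ⊔ F` to
`G` (`T5ContinuousCharacterExtension.exists_extension`, `ℂˣ` is divisible) — and applies it to
the ramified filtration statements of `T5RamifiedUnitFiltration`:

* `exists_character_trivial_on_exact_even_level`: Lemma N5.L4(iv-b) of `route/TIER5.md`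
  §N5.11.4 at the level of `Lˣ = Frac(S)ˣ` — for every `k` a character of `Lˣ` trivial on `F`
  and on `U_E^{2k+2}`, non-trivial on `U_E^{2k+1}` («a conjugate-orthogonal character of exact
  conductor `2k + 2` exists at a ramified place»), `F ≤ Lˣ` any subgroup with
  `F ∩ image(Sˣ) ⊆ image(Rˣ)`;
* `eq_one_of_mem_higherUnits_two_mul`: the parenthetical «no conjugate-orthogonal character of
  odd conductor at a ramified place», for characters of `Lˣ` (residue degree one).

What is NOT here: the local fields themselves and the identification `F = F_v^×` (an
instantiation, not a theorem); continuity (the characters produced are abstract homomorphisms,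
exactly as in the inert file — the conductor clauses are what the chain uses).
Declaration per README §8(d): «uses an L-value-free non-vanishing device: NO».
-/

namespace Summit.Ventures.HodgeRepro2.T5RamifiedCharacterInflation

open T5PrincipalUnitFiltration T5PrincipalUnitComparison

section Glue

variable {G Q : Type*} [CommGroup G] [CommGroup Q]

/-- The character of `U ⊔ F` obtained from a character `χ` of `U` trivial on `U ⊓ F`: descend
`χ` to `U / (F ∩ U)`, transport along the second isomorphism theorem
`U / (F ∩ U) ≃* (U ⊔ F) / F`, and compose with the projection. -/
noncomputable def glue (U F : Subgroup G) (χ : U →* Q) (hχ : ∀ x : U, (x : G) ∈ F → χ x = 1) :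
    ↥(U ⊔ F) →* Q :=
  ((QuotientGroup.lift (F.subgroupOf U) χ
      (fun x hx => MonoidHom.mem_ker.2 (hχ x (Subgroup.mem_subgroupOf.1 hx)))).comp
    (QuotientGroup.quotientInfEquivProdNormalQuotient U F).symm.toMonoidHom).comp
    (QuotientGroup.mk' (F.subgroupOf (U ⊔ F)))

/-- `glue` extends `χ`: on the image of `U` in `U ⊔ F` it is `χ`. -/
theorem glue_inclusion (U F : Subgroup G) (χ : U →* Q) (hχ : ∀ x : U, (x : G) ∈ F → χ x = 1)
    (x : U) : glue U F χ hχ (Subgroup.inclusion le_sup_left x) = χ x := by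
  unfold glue
  simp only [MonoidHom.comp_apply, QuotientGroup.mk'_apply, MulEquiv.coe_toMonoidHom]
  have e : (QuotientGroup.quotientInfEquivProdNormalQuotient U F).symm
      (QuotientGroup.mk (Subgroup.inclusion le_sup_left x) :
        ↥(U ⊔ F) ⧸ F.subgroupOf (U ⊔ F)) = QuotientGroup.mk x :=
    (QuotientGroup.quotientInfEquivProdNormalQuotient U F).symm_apply_apply (QuotientGroup.mk x)
  rw [e, QuotientGroup.lift_mk]

/-- `glue` is trivial on `F`. -/
theorem glue_eq_one_of_mem (U F : Subgroup G) (χ : U →* Q)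
    (hχ : ∀ x : U, (x : G) ∈ F → χ x = 1) (f : ↥(U ⊔ F)) (hf : (f : G) ∈ F) :
    glue U F χ hχ f = 1 := by
  unfold glue
  simp only [MonoidHom.comp_apply, QuotientGroup.mk'_apply, MulEquiv.coe_toMonoidHom]
  have e : (QuotientGroup.mk f : ↥(U ⊔ F) ⧸ F.subgroupOf (U ⊔ F)) = 1 :=
    (QuotientGroup.eq_one_iff f).2 (Subgroup.mem_subgroupOf.2 hf)
  rw [e, map_one, map_one]

variable [RootableBy Q ℤ]

/-- THE GLUING / EXTENSION LEMMA: a character `χ` of a subgroup `U` trivial on `U ⊓ F` extends to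
a character of the whole abelian group `G` trivial on `F` (second isomorphism theorem + Baer). -/
theorem exists_extension_of_eq_one_on_inf (U F : Subgroup G) (χ : U →* Q)
    (hχ : ∀ x : U, (x : G) ∈ F → χ x = 1) :
    ∃ ψ : G →* Q, (∀ x : U, ψ x = χ x) ∧ ∀ f ∈ F, ψ f = 1 := by
  obtain ⟨ψ, hψ⟩ := T5ContinuousCharacterExtension.exists_extension (U ⊔ F) (glue U F χ hχ)
  refine ⟨ψ, fun x => ?_, fun f hf => ?_⟩
  · have h := hψ (Subgroup.inclusion le_sup_left x)
    rw [glue_inclusion] at h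
    simpa using h
  · have h := hψ ⟨f, Subgroup.mem_sup_right hf⟩
    rw [glue_eq_one_of_mem U F χ hχ ⟨f, Subgroup.mem_sup_right hf⟩ hf] at h
    exact h

/-- The same through an injective homomorphism `ι : A →* G`: a character `χ` of `A` trivial on
`ι⁻¹(F)` is `ψ ∘ ι` for a character `ψ` of `G` trivial on `F`. -/
theorem exists_comp_eq_of_eq_one_on_preimage {A : Type*} [CommGroup A] (ι : A →* G)
    (hι : Function.Injective ι) (F : Subgroup G) (χ : A →* Q)
    (hχ : ∀ a, ι a ∈ F → χ a = 1) :
    ∃ ψ : G →* Q, (∀ a, ψ (ι a) = χ a) ∧ ∀ f ∈ F, ψ f = 1 := by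
  obtain ⟨ψ, h1, h2⟩ := exists_extension_of_eq_one_on_inf ι.range F
    (χ.comp (MonoidHom.ofInjective hι).symm.toMonoidHom) (fun x hx => by
      simp only [MonoidHom.comp_apply, MulEquiv.coe_toMonoidHom]
      apply hχ
      rw [← MonoidHom.ofInjective_apply hι, MulEquiv.apply_symm_apply]
      exact hx)
  refine ⟨ψ, fun a => ?_, h2⟩
  have h := h1 (MonoidHom.ofInjective hι a)
  rw [MonoidHom.ofInjective_apply hι] at h
  simpa using h

end Glue

section DVR

variable {R S L : Type*} [CommRing R] [CommRing S] [Algebra R S]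
variable [IsDomain R] [IsDomain S] [IsDiscreteValuationRing R] [IsDiscreteValuationRing S]
variable [Field L] [Algebra S L] [IsFractionRing S L]
variable {π : R} {ϖ : S} {u : Sˣ}

omit [IsDomain S] [IsDiscreteValuationRing S] in
/-- The inclusion `Sˣ →* Lˣ` of the units of `S` into the units of its fraction field is
injective. -/
theorem unitsMapL_injective : Function.Injective (Units.map (algebraMap S L : S →* L)) :=
  Units.map_injective (IsFractionRing.injective S L)

/-- Lemma N5.L4(iv-b) of §N5.11.4 at the level of `Lˣ = Frac(S)ˣ` («`E_v^×`»): for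
`R → S` discrete valuation rings with `algebraMap π = u ϖ²` (ramified quadratic shape), `S` of
finite residue field, and `F ≤ Lˣ` a subgroup whose intersection with the units of `S` lies in
the image of `Rˣ` (the prose «`F_v^× ∩ U_E = U_F`»), for every `k` there is a character of `Lˣ`
trivial on `F` and on `U_E^{2k+2}` and non-trivial on `U_E^{2k+1}` — «a conjugate-orthogonal
character of exact conductor `2k + 2` exists at a ramified place». -/
theorem exists_character_trivial_on_exact_even_level (hπ' : Irreducible π)
    (hϖ : Irreducible ϖ) (hπ : algebraMap R S π = u * ϖ ^ 2)
    [Finite (IsLocalRing.ResidueField S)] (F : Subgroup Lˣ)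
    (hF : ∀ s : Sˣ, Units.map (algebraMap S L : S →* L) s ∈ F → ∃ r : Rˣ, s = unitsMap r)
    (k : ℕ) :
    ∃ χ' : Lˣ →* ℂˣ, (∀ f ∈ F, χ' f = 1) ∧
      (∀ y ∈ higherUnits ϖ (2 * k + 2), χ' (Units.map (algebraMap S L : S →* L) y) = 1) ∧
      ∃ y ∈ higherUnits ϖ (2 * k + 1), χ' (Units.map (algebraMap S L : S →* L) y) ≠ 1 := by
  obtain ⟨χ, h1, h2, y, hy, hy'⟩ :=
    T5RamifiedUnitFiltration.exists_character_exact_even_level hπ' hϖ hπ k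
  obtain ⟨ψ, hψ1, hψ2⟩ := exists_comp_eq_of_eq_one_on_preimage _ (unitsMapL_injective (L := L)) F χ
    (fun s hs => by
      obtain ⟨r, rfl⟩ := hF s hs
      exact h2 r)
  exact ⟨ψ, hψ2, fun z hz => by rw [hψ1]; exact h1 z hz, y, hy, by rw [hψ1]; exact hy'⟩

omit [IsDiscreteValuationRing S] [IsFractionRing S L] in
/-- Lemma N5.L4(iv-a) of §N5.11.4, the extension step: a character `η` of a subgroup `F ≤ Lˣ`
(«`F_v^×`», with `F ∩ image(Sˣ) ⊆ image(Rˣ)`) trivial on the base units of level `t + 1`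
(«`a(η_v) ≤ t + 1`») extends to a character of `Lˣ` trivial on `U_E^{2t+1}` — the prose
«`ω̃₀(x·u) := η_v(x)` is well defined on `F_v^× U_E^{2t+1}` because
`F_v^× ∩ U_E^{2t+1} = U_F^{t+1} ⊆ ker η_v`, and extends to `E_v^×` (A3b)»; the conductor
rule that then pins `a(ω̃) = 2t + 1` is the prose's [FM21-Thm-1.1] and is not claimed here. -/
theorem exists_extension_trivial_on_higherUnits_odd {Q : Type*} [CommGroup Q] [RootableBy Q ℤ]
    (hπ' : Irreducible π) (hϖ : Irreducible ϖ) (hπ : algebraMap R S π = u * ϖ ^ 2)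
    (F : Subgroup Lˣ)
    (hF : ∀ s : Sˣ, Units.map (algebraMap S L : S →* L) s ∈ F → ∃ r : Rˣ, s = unitsMap r)
    (η : F →* Q) (t : ℕ)
    (hη : ∀ (r : Rˣ) (h : Units.map (algebraMap S L : S →* L) (unitsMap r) ∈ F),
      r ∈ higherUnits π (t + 1) → η ⟨_, h⟩ = 1) :
    ∃ ω : Lˣ →* Q, (∀ f : F, ω f = η f) ∧
      ∀ y ∈ higherUnits ϖ (2 * t + 1), ω (Units.map (algebraMap S L : S →* L) y) = 1 := by
  obtain ⟨ω, h1, h2⟩ := exists_extension_of_eq_one_on_inf F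
    ((higherUnits ϖ (2 * t + 1)).map (Units.map (algebraMap S L : S →* L))) η (fun x hx => by
      obtain ⟨y, hy, hyx⟩ := Subgroup.mem_map.1 hx
      have hyF : Units.map (algebraMap S L : S →* L) y ∈ F := by rw [hyx]; exact x.2
      obtain ⟨r, rfl⟩ := hF y hyF
      rw [T5RamifiedUnitFiltration.unitsMap_mem_higherUnits_odd_iff hπ' hϖ hπ] at hy
      have hx' : x = ⟨Units.map (algebraMap S L : S →* L) (unitsMap r), hyF⟩ :=
        Subtype.ext hyx.symm
      rw [hx']
      exact hη r hyF hy)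
  exact ⟨ω, h1, fun y hy => h2 _ (Subgroup.mem_map.2 ⟨y, hy, rfl⟩)⟩

omit [IsDomain S] [IsDiscreteValuationRing S] [IsFractionRing S L] in
/-- The parenthetical of Lemma N5.L4(iv-b) at the level of `Lˣ`: at residue degree one, a
character of `Lˣ` trivial on a subgroup `F` containing the image of `Rˣ` and trivial on
`U_E^{2k+1}` is trivial on `U_E^{2k}` («no conjugate-orthogonal character of odd conductor
exists at a ramified place»). -/
theorem eq_one_of_mem_higherUnits_two_mul {M : Type*} [Monoid M] (hπ' : Irreducible π)
    (hϖ : Irreducible ϖ) (hπ : algebraMap R S π = u * ϖ ^ 2)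
    (hres : ∀ s : S, ∃ a : R, ϖ ∣ s - algebraMap R S a) (F : Subgroup Lˣ)
    (hF : ∀ r : Rˣ, Units.map (algebraMap S L : S →* L) (unitsMap r) ∈ F) (k : ℕ)
    (χ' : Lˣ →* M) (hχF : ∀ f ∈ F, χ' f = 1)
    (hχ : ∀ y ∈ higherUnits ϖ (2 * k + 1), χ' (Units.map (algebraMap S L : S →* L) y) = 1) :
    ∀ y ∈ higherUnits ϖ (2 * k), χ' (Units.map (algebraMap S L : S →* L) y) = 1 :=
  T5RamifiedUnitFiltration.eq_one_of_mem_higherUnits_two_mul hπ' hϖ hπ hres k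
    (χ'.comp (Units.map (algebraMap S L : S →* L))) hχ (fun r => hχF _ (hF r))

end DVR

end Summit.Ventures.HodgeRepro2.T5RamifiedCharacterInflation
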